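import Literature.Analysis.FunctionSpaces.PointConfigCountableGenerators
import Mathlib.MeasureTheory.Measure.SeparableMeasure
import Mathlib.MeasureTheory.SetAlgebra
import Mathlib.Topology.Compactness.SigmaCompact
import Mathlib.Data.Set.BoolIndicator
import Mathlib.Data.Nat.Pairing
import HarnessLib

/-!
# Count filtrations of point configurations

(topic Analysis/FunctionSpaces, next to `PointConfigCountableGenerators`; no new definitions, no
new named facts.)

On a σ-compact (e.g. locally compact) second countable Hausdorff space `E` with its Borel
σ-algebra we construct a **count filtration** of the σ-algebra of locally finite simple
configurations `PointConfig E` (`PointConfig.instMeasurableSpace`; Kingman 1993, §2.1;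
Last–Penrose 2017, §2.1): finite families `t k : Fin (r k) → Set E` of pairwise disjoint,
measurable, relatively compact cells whose count-cylinder σ-algebras
`𝓕 k := σ(N(t k j), j) = ⨆ j, ⊤.comap (c ↦ N_c(t k j))` increase with `k` and generate the count
σ-algebra, `⨆ k, 𝓕 k = PointConfig.instMeasurableSpace` (`PointConfig.exists_count_filtration`).
Consequently (a generating filtration is a measure-dense set algebra:
`measureDense_iUnion_setOf_measurableSet`, from Mathlib's
`Measure.MeasureDense.of_generateFrom_isSetAlgebra_finite`) every event of configurations is
approximated in measure, under any finite law, by **count cylinders** `{c | (N_c(t k j))_j ∈ T}` of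
a single level (`PointConfig.measurableSet_iSup_comap_count_iff`,
`PointConfig.exists_count_cylinder_approx`) — the discretisation step of martingale (Lévy upward)
proofs about Poisson functionals such as the Harris–FKG inequality (Last–Penrose 2017, Thm. 20.4;
martingale proof via finitely many counts: Meester–Roy 1996, Ch. 2).

Construction (`PointConfig.exists_count_filtration_of_seq`): take measurable relatively compact
sets `V 0, V 1, …` generating the Borel σ-algebra, among them the members of the exhaustion
`compactCovering E` (`exists_seq_measurableSet_isCompact_generateFrom`). The level-`k` cells are the
fibres of the **membership pattern** `x ↦ (𝟙[x ∈ V j])_{j ≤ k}` over the patterns with a `true`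
entry — Kingman's disjoint sets `A₁* ∩ ⋯ ∩ Aₙ*` (1993, §2.1, p. 12); the fibre of the zero pattern
is the unbounded complement of `V 0 ∪ ⋯ ∪ V k`. The level-`k` pattern is the restriction of the
level-`(k+1)` pattern, so a level-`k` cell is a level-`(k+1)` pattern event and its count is a sum
of counts of level-`(k+1)` cells (`PointConfig.count_preimage_finset`): `𝓕 k ≤ 𝓕 (k+1)`.
The nonempty finite intersections of the `V j` form a generating π-system containing the
exhaustion, each a finite union of cells of one level, so
`PointConfig.measurableSpace_eq_iSup_comap_count_of_generateFrom` gives generation.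

## References

* J. F. C. Kingman, *Poisson Processes*, Oxford University Press (1993), §2.1 (the counts `N(A)`;
  the disjoint sets `A₁* ∩ ⋯ ∩ Aₙ*`, p. 12, display (2.5)). [cite: Kingman1993, §2.1]
* G. Last, M. Penrose, *Lectures on the Poisson Process*, Cambridge University Press (2017), §2.1
  (the σ-field `𝒩`), Thm. 20.4 (Harris–FKG). [cite: LastPenrose2017, §2.1]
* R. Meester, R. Roy, *Continuum Percolation*, Cambridge University Press (1996), Ch. 2.
-/

open MeasureTheory Set TopologicalSpace
open scoped ENNReal symmDiff

namespace Literature.Analysis.FunctionSpaces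

/-! ## Events of an increasing sequence of σ-algebras: a measure-dense set algebra -/

section Filtration

variable {α : Type*}

/-- The events measurable for some member of an increasing sequence of σ-algebras `m k` form an
algebra of sets (`∅`; complements at the same level; unions at the larger level). [folklore] -/
theorem isSetAlgebra_iUnion_setOf_measurableSet {m : ℕ → MeasurableSpace α} (hm : Monotone m) :
    IsSetAlgebra (⋃ k, {A : Set α | MeasurableSet[m k] A}) where
  empty_mem := mem_iUnion.2 ⟨0, @MeasurableSet.empty _ (m 0)⟩
  compl_mem := fun A hA => by
    obtain ⟨k, hk⟩ := mem_iUnion.1 hA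
    exact mem_iUnion.2 ⟨k, MeasurableSet.compl (m := m k) hk⟩
  union_mem := fun A B hA hB => by
    obtain ⟨k, hk⟩ := mem_iUnion.1 hA
    obtain ⟨l, hl⟩ := mem_iUnion.1 hB
    exact mem_iUnion.2 ⟨max k l, @MeasurableSet.union _ (m (max k l)) _ _
      (hm (le_max_left k l) _ hk) (hm (le_max_right k l) _ hl)⟩

/-- **A generating filtration is measure-dense**: if the σ-algebras `m k` increase with `k` and
`⨆ k, m k` is the ambient σ-algebra, then for every finite measure `μ` the events measurable at
some finite level are measure-dense (Mathlib's `of_generateFrom_isSetAlgebra_finite` for the set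
algebra `isSetAlgebra_iUnion_setOf_measurableSet`, which generates `⨆ k, m k`). [folklore] -/
theorem measureDense_iUnion_setOf_measurableSet [m₀ : MeasurableSpace α]
    {m : ℕ → MeasurableSpace α} (hm : Monotone m) (hgen : ⨆ k, m k = m₀) (μ : Measure α)
    [IsFiniteMeasure μ] : μ.MeasureDense (⋃ k, {A : Set α | MeasurableSet[m k] A}) :=
  Measure.MeasureDense.of_generateFrom_isSetAlgebra_finite μ
    (isSetAlgebra_iUnion_setOf_measurableSet hm)
    ((MeasurableSpace.generateFrom_iUnion_measurableSet m).trans hgen).symm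

/-- **Approximation of events along a generating filtration**: under the hypotheses of
`measureDense_iUnion_setOf_measurableSet`, for every event `A` and `ε > 0` there is an event `B`
of some finite level `k` with `μ (A ∆ B) < ε`. [folklore] -/
theorem exists_measureReal_symmDiff_lt_of_iSup_eq [m₀ : MeasurableSpace α]
    {m : ℕ → MeasurableSpace α} (hm : Monotone m) (hgen : ⨆ k, m k = m₀) (μ : Measure α)
    [IsFiniteMeasure μ] {A : Set α} (hA : MeasurableSet A) {ε : ℝ} (hε : 0 < ε) :
    ∃ (k : ℕ) (B : Set α), MeasurableSet[m k] B ∧ μ.real (A ∆ B) < ε := by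
  obtain ⟨B, hB, hAB⟩ := (measureDense_iUnion_setOf_measurableSet hm hgen μ).approx A hA
    (measure_ne_top μ A) ε hε
  obtain ⟨k, hk⟩ := mem_iUnion.1 hB
  exact ⟨k, B, hk, ENNReal.toReal_lt_of_lt_ofReal hAB⟩

end Filtration

variable {E : Type*}

/-! ## Count σ-algebras of finite families are pulled back from the count vector -/

namespace PointConfig

section CountVector

variable [TopologicalSpace E]

/-- The σ-algebra generated by the counts of a family of sets `t j` is the pull-back of the
product σ-algebra under the count vector `c ↦ (N_c(t j))_j` (`comap` commutes with `⨆`).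
[folklore] -/
theorem iSup_comap_count_eq_comap {ι : Type*} (t : ι → Set E) :
    (⨆ j, (⊤ : MeasurableSpace ℕ∞).comap fun c : PointConfig E => c.count (t j)) =
      MeasurableSpace.comap (fun (c : PointConfig E) (j : ι) => c.count (t j))
        MeasurableSpace.pi := by
  simp only [MeasurableSpace.pi, MeasurableSpace.comap_iSup, MeasurableSpace.comap_comp]
  rfl

/-- **Events of a finite count σ-algebra are count cylinders**: for a finite family `t j`, an event
of configurations is measurable for `σ(N(t j), j)` iff it is a cylinder `{c | (N_c(t j))_j ∈ T}`
for some set `T` of count vectors (every `T ⊆ (ι → ℕ∞)` is measurable, the type being countable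
and discrete). [folklore] -/
theorem measurableSet_iSup_comap_count_iff {ι : Type*} [Finite ι] (t : ι → Set E)
    {A : Set (PointConfig E)} :
    MeasurableSet[⨆ j, (⊤ : MeasurableSpace ℕ∞).comap fun c : PointConfig E => c.count (t j)] A ↔
      ∃ T : Set (ι → ℕ∞), (fun (c : PointConfig E) (j : ι) => c.count (t j)) ⁻¹' T = A := by
  rw [iSup_comap_count_eq_comap]
  constructor
  · rintro ⟨T, -, rfl⟩
    exact ⟨T, rfl⟩
  · rintro ⟨T, rfl⟩
    exact ⟨T, T.to_countable.measurableSet, rfl⟩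

variable [MeasurableSpace E]

/-- **Measure density of count cylinders.** Let `t k : ι k → Set E` (`ι k` finite) be families of
sets whose count σ-algebras `𝓕 k := σ(N(t k j), j)` increase with `k` and generate the count
σ-algebra of configurations (e.g. the output of `exists_count_filtration`). Then for every finite
measure `P` on configurations, every event `A` and every `ε > 0` there is a count cylinder
`{c | (N_c(t k j))_j ∈ T}` of some level `k` with `P (A ∆ {c | (N_c(t k j))_j ∈ T}) < ε` (the
discretisation step of martingale proofs about Poisson functionals, e.g. of the Harris–FKG
inequality, Meester–Roy 1996, Ch. 2). [folklore] -/
theorem exists_count_cylinder_approx {ι : ℕ → Type*} [∀ k, Finite (ι k)] {t : ∀ k, ι k → Set E}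
    (hmono : Monotone fun k =>
      ⨆ j, (⊤ : MeasurableSpace ℕ∞).comap fun c : PointConfig E => c.count (t k j))
    (hgen : (⨆ k, ⨆ j, (⊤ : MeasurableSpace ℕ∞).comap fun c : PointConfig E => c.count (t k j)) =
      (PointConfig.instMeasurableSpace : MeasurableSpace (PointConfig E)))
    (P : Measure (PointConfig E)) [IsFiniteMeasure P] {A : Set (PointConfig E)}
    (hA : MeasurableSet A) {ε : ℝ} (hε : 0 < ε) :
    ∃ (k : ℕ) (T : Set (ι k → ℕ∞)),
      P.real (A ∆ ((fun (c : PointConfig E) (j : ι k) => c.count (t k j)) ⁻¹' T)) < ε := by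
  obtain ⟨k, B, hB, hlt⟩ := exists_measureReal_symmDiff_lt_of_iSup_eq hmono hgen P hA hε
  obtain ⟨T, rfl⟩ := (measurableSet_iSup_comap_count_iff (t k)).1 hB
  exact ⟨k, T, hlt⟩

end CountVector

end PointConfig

/-! ## The generating sequence of relatively compact sets -/

/-- On a σ-compact second countable Hausdorff space with its Borel σ-algebra there is a sequence of
measurable, relatively compact sets `V n` generating the Borel σ-algebra and passing through the
compact exhaustion `compactCovering E` (the members of a countable basis, and `univ`, cut by the
members of `compactCovering E`). [folklore] -/
theorem exists_seq_measurableSet_isCompact_generateFrom [TopologicalSpace E] [T2Space E]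
    [SecondCountableTopology E] [SigmaCompactSpace E] [MeasurableSpace E] [BorelSpace E] :
    ∃ V : ℕ → Set E, (∀ n, MeasurableSet (V n)) ∧ (∀ n, ∃ K, IsCompact K ∧ V n ⊆ K) ∧
      MeasurableSpace.generateFrom (range V) = ‹MeasurableSpace E› ∧
      ∀ m, ∃ n, V n = compactCovering E m := by
  obtain ⟨b, hbc, -, hb⟩ := TopologicalSpace.exists_countable_basis E
  obtain ⟨u, hu⟩ := (hbc.insert univ).exists_eq_range (insert_nonempty _ _)
  have humeas : ∀ i, MeasurableSet (u i) := fun i => by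
    have hi : u i ∈ insert univ b := hu ▸ mem_range_self i
    rcases hi with h | h
    · rw [h]; exact MeasurableSet.univ
    · exact (hb.isOpen h).measurableSet
  set V : ℕ → Set E := fun n => u (Nat.unpair n).1 ∩ compactCovering E (Nat.unpair n).2 with hV
  have hVpair : ∀ i m, V (Nat.pair i m) = u i ∩ compactCovering E m := fun i m => by
    simp only [hV, Nat.unpair_pair]
  have hVmeas : ∀ n, MeasurableSet (V n) := fun n =>
    (humeas _).inter (isCompact_compactCovering E _).measurableSet
  refine ⟨V, hVmeas, fun n => ⟨_, isCompact_compactCovering E _, inter_subset_right⟩, ?_,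
    fun m => ?_⟩
  · apply le_antisymm
    · exact MeasurableSpace.generateFrom_le (by rintro _ ⟨n, rfl⟩; exact hVmeas n)
    · rw [BorelSpace.measurable_eq (α := E), hb.borel_eq_generateFrom]
      refine MeasurableSpace.generateFrom_le fun s hs => ?_
      have hs' : s ∈ range u := hu ▸ mem_insert_of_mem _ hs
      obtain ⟨i, rfl⟩ := hs'
      have hsplit : u i = ⋃ m, V (Nat.pair i m) := by
        simp_rw [hVpair]
        rw [← inter_iUnion, iUnion_compactCovering, inter_univ]
      rw [hsplit]
      exact MeasurableSet.iUnion fun m =>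
        MeasurableSpace.measurableSet_generateFrom (mem_range_self _)
  · have huniv : (univ : Set E) ∈ range u := hu ▸ mem_insert _ _
    obtain ⟨i₀, hi₀⟩ := huniv
    exact ⟨Nat.pair i₀ m, by rw [hVpair, hi₀, univ_inter]⟩

/-! ## Membership patterns of a family of sets and their fibres (the cells) -/

section Cells

variable {κ : Type*} (s : κ → Set E)

/-- The membership pattern map `x ↦ (𝟙[x ∈ s j])_j : E → (κ → Bool)` of a family of measurable
sets is measurable. [folklore] -/
theorem measurable_boolIndicator_pi [MeasurableSpace E] (hs : ∀ j, MeasurableSet (s j)) :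
    Measurable fun (x : E) (j : κ) => Set.boolIndicator (s j) x := by
  refine measurable_pi_lambda _ fun j => measurable_to_countable' fun b => ?_
  rcases (s j).preimage_boolIndicator {b} with h | h | h | h
  · rw [h]; exact MeasurableSet.univ
  · rw [h]; exact hs j
  · rw [h]; exact (hs j).compl
  · rw [h]; exact MeasurableSet.empty

/-- A cell (fibre of the membership pattern map) whose pattern selects `s j` lies inside `s j`
(Kingman 1993, §2.1, p. 12: the disjoint sets `A₁* ∩ ⋯ ∩ Aₙ*` refine the `Aⱼ`). [folklore] -/
theorem boolIndicator_pi_preimage_singleton_subset {w : κ → Bool} {j : κ} (hj : w j = true) :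
    (fun (x : E) (j : κ) => Set.boolIndicator (s j) x) ⁻¹' {w} ⊆ s j := fun x hx => by
  have h : (fun j : κ => Set.boolIndicator (s j) x) = w := hx
  exact ((s j).mem_iff_boolIndicator x).2 ((congr_fun h j).trans hj)

end Cells

namespace PointConfig

variable [TopologicalSpace E]

/-- **Counts of preimages are sums of counts of fibres**: for a map `f : E → β` and a finite set
`T`, `N_c(f⁻¹ T) = ∑_{b ∈ T} N_c(f⁻¹ {b})`, the fibres being pairwise disjoint (for the pattern
map: Kingman 1993, §2.1, display (2.5)). [cite: Kingman1993, §2.1] -/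
theorem count_preimage_finset {β : Type*} (c : PointConfig E) (f : E → β) (T : Finset β) :
    c.count (f ⁻¹' ↑T) = ∑ b ∈ T, c.count (f ⁻¹' {b}) := by
  rw [← Set.biUnion_preimage_singleton]
  exact c.count_biUnion_finset T _ fun b _ b' _ hne => Disjoint.preimage _ (disjoint_singleton.2 hne)

/-- The count of the preimage of a finite set `T ⊆ {b | p b}` is measurable for the σ-algebra
generated by the counts of the fibres over `{b | p b}` (a finite sum of generators). [folklore] -/
theorem measurable_count_preimage_finset {β : Type*} (f : E → β) {p : β → Prop} (T : Finset β)
    (hT : ∀ b ∈ T, p b) :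
    Measurable[⨆ b : {b : β // p b},
        (⊤ : MeasurableSpace ℕ∞).comap fun c : PointConfig E => c.count (f ⁻¹' {b.1})]
      fun c : PointConfig E => c.count (f ⁻¹' ↑T) := by
  rw [show (fun c : PointConfig E => c.count (f ⁻¹' ↑T)) =
      fun c => ∑ b ∈ T, c.count (f ⁻¹' {b}) from funext fun c => c.count_preimage_finset f T]
  refine Finset.measurable_sum T fun b hb => ?_
  rw [measurable_iff_comap_le]
  exact le_iSup (fun b' : {b : β // p b} =>
    (⊤ : MeasurableSpace ℕ∞).comap fun c : PointConfig E => c.count (f ⁻¹' {b'.1})) ⟨b, hT b hb⟩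

/-! ## Count filtrations -/

variable [MeasurableSpace E]

/-- **Count filtrations from a generating sequence.** Let `V 0, V 1, …` be measurable, relatively
compact sets generating the σ-algebra of `E` and passing through a monotone exhaustion `S m ↑ E`.
Then the cells `V₀* ∩ ⋯ ∩ V_k*` (`Vⱼ* ∈ {Vⱼ, Vⱼᶜ}`, at least one `Vⱼ`: the fibres of the
membership pattern `x ↦ (𝟙[x ∈ V j])_{j ≤ k}` over the nonzero patterns, reindexed by `Fin (r k)`)
form finite families of **measurable, relatively compact, pairwise disjoint** sets whose
count-cylinder σ-algebras `𝓕 k := ⨆ j, ⊤.comap (c ↦ N_c(t k j))` **increase** with `k` (the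
level-`k` pattern is the restriction of the level-`(k+1)` pattern, so a level-`k` cell is a
disjoint union of level-`(k+1)` cells) and **generate** the count σ-algebra of configurations
(Kingman 1993, §2.1, the disjoint sets `A₁* ∩ ⋯ ∩ Aₙ*`; generation by
`measurableSpace_eq_iSup_comap_count_of_generateFrom` for the π-system of nonempty finite
intersections of the `V j`, each a finite union of cells of one level). [cite: Kingman1993, §2.1] -/
theorem exists_count_filtration_of_seq {V : ℕ → Set E} (hVm : ∀ n, MeasurableSet (V n))
    (hVK : ∀ n, ∃ K, IsCompact K ∧ V n ⊆ K)
    (hVgen : MeasurableSpace.generateFrom (range V) = ‹MeasurableSpace E›) {S : ℕ → Set E}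
    (hSV : ∀ m, ∃ n, V n = S m) (hSmono : Monotone S) (hSU : ⋃ m, S m = univ) :
    ∃ (r : ℕ → ℕ) (t : ∀ k, Fin (r k) → Set E),
      (∀ k j, MeasurableSet (t k j) ∧ ∃ K, IsCompact K ∧ t k j ⊆ K) ∧
      (∀ k, Pairwise (Function.onFun Disjoint (t k))) ∧
      Monotone (fun k =>
        ⨆ j, (⊤ : MeasurableSpace ℕ∞).comap fun c : PointConfig E => c.count (t k j)) ∧
      (⨆ k, ⨆ j, (⊤ : MeasurableSpace ℕ∞).comap fun c : PointConfig E => c.count (t k j)) =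
        (PointConfig.instMeasurableSpace : MeasurableSpace (PointConfig E)) := by
  classical
  -- the level-`k` membership pattern map; the nonzero patterns index the cells of level `k`
  let π : ∀ k : ℕ, E → (Fin (k + 1) → Bool) := fun k x j => Set.boolIndicator (V j) x
  let ι : ℕ → Type := fun k => {w : Fin (k + 1) → Bool // ∃ j, w j = true}
  let eqv : ∀ k, ι k ≃ Fin (Fintype.card (ι k)) := fun k => Fintype.equivFin (ι k)
  have hπ : ∀ k, Measurable (π k) := fun k =>
    measurable_boolIndicator_pi (fun j : Fin (k + 1) => V j) fun j => hVm j
  -- the count-cylinder σ-algebras, indexed by patterns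
  set 𝓕 : ℕ → MeasurableSpace (PointConfig E) := fun k =>
    ⨆ w : ι k, (⊤ : MeasurableSpace ℕ∞).comap fun c : PointConfig E => c.count (π k ⁻¹' {w.1})
    with h𝓕
  -- monotonicity: a level-`k` cell is a level-`(k+1)` pattern event avoiding the zero pattern
  have hmono : Monotone 𝓕 := by
    refine monotone_nat_of_le_succ fun k => iSup_le fun w => ?_
    rw [← measurable_iff_comap_le]
    set T : Finset (Fin (k + 2) → Bool) :=
      Finset.univ.filter fun w' => (fun j : Fin (k + 1) => w' j.castSucc) = w.1 with hT
    have hset : π k ⁻¹' {w.1} = π (k + 1) ⁻¹' ↑T := Set.ext fun x => by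
      simp only [mem_preimage, mem_singleton_iff, hT, Finset.coe_filter, Finset.mem_univ,
        true_and, mem_setOf_eq]
      exact Iff.rfl
    have hT' : ∀ w' ∈ T, ∃ j, w' j = true := fun w' hw' => by
      obtain ⟨j, hj⟩ := w.2
      exact ⟨j.castSucc, (congr_fun (Finset.mem_filter.1 hw').2 j).trans hj⟩
    rw [hset]
    exact measurable_count_preimage_finset (π (k + 1)) T hT'
  -- generation, through the π-system of nonempty finite intersections of the `V j`
  set 𝒮 : Set (Set E) := {s | ∃ F : Finset ℕ, F.Nonempty ∧ s = ⋂ j ∈ F, V j} with h𝒮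
  have hpi : IsPiSystem 𝒮 := by
    rintro _ ⟨F, hF, rfl⟩ _ ⟨G, -, rfl⟩ -
    exact ⟨F ∪ G, hF.mono Finset.subset_union_left, (Finset.set_biInter_inter F G V).symm⟩
  have hgenE : MeasurableSpace.generateFrom 𝒮 = ‹MeasurableSpace E› := by
    apply le_antisymm
    · refine MeasurableSpace.generateFrom_le ?_
      rintro _ ⟨F, -, rfl⟩
      exact F.measurableSet_biInter fun j _ => hVm j
    · rw [← hVgen]
      refine MeasurableSpace.generateFrom_le ?_
      rintro _ ⟨n, rfl⟩
      exact MeasurableSpace.measurableSet_generateFrom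
        ⟨{n}, Finset.singleton_nonempty n, (Finset.set_biInter_singleton n V).symm⟩
  have hS : ∀ m, S m ∈ 𝒮 := fun m => by
    obtain ⟨n, hn⟩ := hSV m
    exact ⟨{n}, Finset.singleton_nonempty n, by rw [Finset.set_biInter_singleton, hn]⟩
  have hSfin : ∀ (c : PointConfig E) (m : ℕ), c.count (S m) < ⊤ := fun c m => by
    obtain ⟨n, hn⟩ := hSV m
    obtain ⟨K, hK, hnK⟩ := hVK n
    exact (c.count_mono (hn ▸ hnK)).trans_lt (c.count_lt_top_of_isCompact hK)
  have key := measurableSpace_eq_iSup_comap_count_of_generateFrom hpi hgenE hS hSmono hSU hSfin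
  -- counts of members of `𝒮` are measurable for `⨆ k, 𝓕 k`
  have hcount : ∀ s ∈ 𝒮, Measurable[⨆ k, 𝓕 k] fun c : PointConfig E => c.count s := by
    rintro _ ⟨F, hF, rfl⟩
    set k := F.sup id
    have hjk : ∀ j ∈ F, j < k + 1 := fun j hj => Nat.lt_succ_of_le (Finset.le_sup (f := id) hj)
    set T : Finset (Fin (k + 1) → Bool) :=
      Finset.univ.filter fun w => ∀ j : Fin (k + 1), (j : ℕ) ∈ F → w j = true with hT
    have hset : (⋂ j ∈ F, V j) = π k ⁻¹' ↑T := by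
      ext x
      simp only [hT, Finset.coe_filter, mem_iInter, mem_preimage, Finset.mem_univ, true_and,
        mem_setOf_eq]
      exact ⟨fun hx j hj => ((V (j : ℕ)).mem_iff_boolIndicator x).1 (hx j hj),
        fun hx j hj => ((V j).mem_iff_boolIndicator x).2 (hx ⟨j, hjk j hj⟩ hj)⟩
    have hT' : ∀ w ∈ T, ∃ j, w j = true := fun w hw => by
      obtain ⟨j₀, hj₀⟩ := hF
      exact ⟨⟨j₀, hjk j₀ hj₀⟩, (Finset.mem_filter.1 hw).2 _ hj₀⟩
    rw [hset]
    exact (measurable_count_preimage_finset (π k) T hT').mono (le_iSup 𝓕 k) le_rfl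
  have hgen : (⨆ k, 𝓕 k) = PointConfig.instMeasurableSpace := by
    apply le_antisymm
    · exact iSup_le fun k => iSup_le fun w =>
        (measurable_count (hπ k (measurableSet_singleton _))).comap_le
    · rw [← key]
      exact iSup₂_le fun s hs => (hcount s hs).comap_le
  -- reindex the cells by `Fin (r k)`
  have hre : ∀ k, (⨆ i : Fin (Fintype.card (ι k)), (⊤ : MeasurableSpace ℕ∞).comap
      fun c : PointConfig E => c.count (π k ⁻¹' {((eqv k).symm i).1})) = 𝓕 k := fun k =>
    Equiv.iSup_comp (g := fun w : ι k =>
      (⊤ : MeasurableSpace ℕ∞).comap fun c : PointConfig E => c.count (π k ⁻¹' {w.1}))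
      (eqv k).symm
  refine ⟨fun k => Fintype.card (ι k), fun k i => π k ⁻¹' {((eqv k).symm i).1},
    fun k i => ⟨hπ k (measurableSet_singleton _), ?_⟩, fun k i i' hne => ?_, ?_, ?_⟩
  · obtain ⟨j, hj⟩ := ((eqv k).symm i).2
    obtain ⟨K, hK, hVK'⟩ := hVK j
    exact ⟨K, hK, (boolIndicator_pi_preimage_singleton_subset _ hj).trans hVK'⟩
  · exact Disjoint.preimage _ (disjoint_singleton.2 fun h =>
      hne ((eqv k).symm.injective (Subtype.ext h)))
  · rw [show (fun k => ⨆ i : Fin (Fintype.card (ι k)), (⊤ : MeasurableSpace ℕ∞).comap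
        fun c : PointConfig E => c.count (π k ⁻¹' {((eqv k).symm i).1})) = 𝓕 from funext hre]
    exact hmono
  · rw [iSup_congr hre]
    exact hgen

end PointConfig

/-- **Count filtrations** (count σ-algebra and the disjoint sets `A₁* ∩ ⋯ ∩ Aₙ*`: Kingman 1993,
§2.1; Last–Penrose 2017, §2.1; used for Harris–FKG, Last–Penrose Thm. 20.4). On a σ-compact
(e.g. locally compact) second countable Hausdorff space with its Borel σ-algebra there are finite
families `t k : Fin (r k) → Set E`, `k ∈ ℕ`, of **measurable, relatively compact, pairwise
disjoint** cells such that the count-cylinder σ-algebras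
`𝓕 k := ⨆ j, ⊤.comap (c ↦ N_c(t k j)) = σ(N(t k j), j)` **increase** with `k` (the families
refine) and **generate** the count σ-algebra of configurations,
`⨆ k, 𝓕 k = PointConfig.instMeasurableSpace` (`exists_count_filtration_of_seq` for the sequence
of `exists_seq_measurableSet_isCompact_generateFrom`, exhausted by `compactCovering E`). With
`exists_count_cylinder_approx`: every event of configurations is approximated in any finite law by
count cylinders of a single level. [cite: Kingman1993, §2.1] -/
theorem PointConfig.exists_count_filtration [TopologicalSpace E] [T2Space E]
    [SecondCountableTopology E] [SigmaCompactSpace E] [MeasurableSpace E] [BorelSpace E] :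
    ∃ (r : ℕ → ℕ) (t : ∀ k, Fin (r k) → Set E),
      (∀ k j, MeasurableSet (t k j) ∧ ∃ K, IsCompact K ∧ t k j ⊆ K) ∧
      (∀ k, Pairwise (Function.onFun Disjoint (t k))) ∧
      Monotone (fun k =>
        ⨆ j, (⊤ : MeasurableSpace ℕ∞).comap fun c : PointConfig E => c.count (t k j)) ∧
      (⨆ k, ⨆ j, (⊤ : MeasurableSpace ℕ∞).comap fun c : PointConfig E => c.count (t k j)) =
        (PointConfig.instMeasurableSpace : MeasurableSpace (PointConfig E)) := by
  obtain ⟨V, hVm, hVK, hVgen, hVcov⟩ := exists_seq_measurableSet_isCompact_generateFrom (E := E)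
  exact PointConfig.exists_count_filtration_of_seq hVm hVK hVgen hVcov
    (fun _ _ hab => compactCovering_subset E hab) (iUnion_compactCovering E)

end Literature.Analysis.FunctionSpaces
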